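import Mathlib.Tactic.Group
import Mathlib.Tactic.LinearCombination
import Mathlib.Analysis.Normed.Module.Basic
import Literature.NumberTheory.GaloisRepresentations.ContinuousH2
import HarnessLib

/-!
# The `E₂^{1,1}` class of a split extension: an explicit continuous `2`-cocycle on `N ⋊ Q`

Topic `NumberTheory/GaloisRepresentations` (continuous group cohomology, element level).  Theorems
only (no definition, no named fact).

Let `P` be a topological group, `π : P ↠ Q` a continuous homomorphism with kernel `N` and
`σ : Q → P` a continuous homomorphic SECTION (`π ∘ σ = id`), so that `P = N ⋊ σ(Q)`.  `Q` acts on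
the continuous additive characters `v : N → 𝕜` by `(q · v)(a) = v(σ(q)⁻¹ a σ(q))`.  For a crossed
homomorphism `ξ : Q → {continuous additive characters of N}` (`ξ(q₁q₂) = ξ(q₁) + q₁ · ξ(q₂)`, jointly
continuous) the function

  `c_ξ(x, y) := ξ(π x)(σ(π x) · y σ(π y)⁻¹ · σ(π x)⁻¹)`      (`x, y ∈ P`)

is a continuous inhomogeneous `2`-cocycle of `P` with TRIVIAL coefficients `𝕜`
(`exists_contTwoCocycle_of_split`), and its class in `H²_cont(P, 𝕜)` (Mathlib's
`continuousCohomology`, coefficient object `ULift 𝕜` as in the [AbsTopI] invariant `δ²_l`) vanishes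
only if `ξ` is principal, `ξ(q) = q · v - v` for a continuous additive character `v` of `N`
(`twoCocycleClass_ne_zero_of_split`).  This is the edge map `H¹(Q, H¹(N, 𝕜)) = E₂^{1,1} → H²(P, 𝕜)`
of the Hochschild–Serre spectral sequence made explicit in the split case, where no `H³(Q, –)`
obstruction intervenes (Neukirch–Schmidt–Wingberg (2.4.3)–(2.4.4); for the semidirect product the
cocycle is written down directly and injectivity is checked by restriction to `N × N`, `N × σ(Q)`,
`σ(Q) × N`).

Used by the abc-iut cell (row «HOOK-FROM-SIGMA-STAR») to produce `δ²_l(J₁) ≥ 1` for a split open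
subgroup `J₁ = Δ₁ ⋊ Q₁` of `Π` in the proof of [AbsTopI] Thm 2.6 (iii) (S. Mochizuki, *Topics in
Absolute Anabelian Geometry I*, p. 23: "a pair of injections
`H¹(G, Hom(R_l, ℚ_l)) ↪ H¹(G, Hom(Δ^{ab-t}, ℚ_l)) ↪ H²(Π, ℚ_l)`").  Classical; nothing here bears on
[IUTchIII] Cor. 3.12.

## References
* J. Neukirch, A. Schmidt, K. Wingberg, *Cohomology of Number Fields*, 2nd ed. (2008), (2.4.3),
  (2.4.4) (edge maps and the transgression of the Hochschild–Serre spectral sequence).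
  [NeukirchSchmidtWingberg2008]
* S. Mochizuki, *Topics in Absolute Anabelian Geometry I: Generalities*, J. Math. Sci. Univ. Tokyo 19
  (2012), proof of Thm 2.6 (iii) p. 23. [MochizukiAbsTopI2012]
-/

noncomputable section

namespace Literature.NumberTheory.GaloisRepresentations

open _root_.TopRep _root_.ContRepresentation

universe v w

variable {𝕜 : Type} [NormedField 𝕜]
variable {P : Type v} [Group P] [TopologicalSpace P] [IsTopologicalGroup P]
variable {Q : Type w} [Group Q] [TopologicalSpace Q]

omit [IsTopologicalGroup P] in
/-- For a continuous homomorphism `π : P → Q` with a homomorphic section `σ`, the element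
`y σ(π y)⁻¹` lies in the kernel `N` of `π`. [cite: NeukirchSchmidtWingberg2008, (2.4.3)] -/
theorem mul_section_inv_mem_of_split (π : P →ₜ* Q) (N : Subgroup P) (hN : ∀ x : P, x ∈ N ↔ π x = 1)
    (σ : Q →ₜ* P) (hσ : ∀ q : Q, π (σ q) = q) (y : P) : y * (σ (π y))⁻¹ ∈ N := by
  rw [hN, map_mul, map_inv, hσ, mul_inv_cancel]

/-- **The explicit `2`-cocycle of a split extension** (trivial coefficients).  For `P = N ⋊ σ(Q)` and
a jointly continuous crossed homomorphism `ξ` of `Q` into the continuous additive characters of `N`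
(`ξ(q₁q₂)(a) = ξ(q₁)(a) + ξ(q₂)(σ(q₁)⁻¹ a σ(q₁))`), the function
`c(x, y) = ξ(π x)(σ(π x) · y σ(π y)⁻¹ · σ(π x)⁻¹)` is a continuous inhomogeneous `2`-cocycle of `P`
with coefficients in the trivial representation on `ULift 𝕜`; and if its class vanishes then `ξ` is
principal: `ξ(q)(a) = v(σ(q)⁻¹ a σ(q)) - v(a)` for a continuous additive `v : N → 𝕜` (namely the
restriction to `N` of a continuous cochain bounding `c`). [cite: NeukirchSchmidtWingberg2008, (2.4.4)] -/
theorem exists_contTwoCocycle_of_split [LocallyCompactSpace P] (π : P →ₜ* Q) (N : Subgroup P)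
    [N.Normal] (hN : ∀ x : P, x ∈ N ↔ π x = 1) (σ : Q →ₜ* P) (hσ : ∀ q : Q, π (σ q) = q)
    (ξ : Q → N → 𝕜) (hadd : ∀ (q : Q) (a b : N), ξ q (a * b) = ξ q a + ξ q b)
    (hcross : ∀ (q₁ q₂ : Q) (a : N), ξ (q₁ * q₂) a = ξ q₁ a + ξ q₂ (MulAut.conjNormal (σ q₁)⁻¹ a))
    (hcont : Continuous fun p : Q × N => ξ p.1 p.2) :
    ∃ f : contTwoCocycles (TopRep.of (ContRepresentation.trivial 𝕜 P (ULift.{v} 𝕜))),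
      (∀ x y : P, (f.1 (x, y)).down =
        ξ (π x) (MulAut.conjNormal (σ (π x))
          ⟨y * (σ (π y))⁻¹, mul_section_inv_mem_of_split π N hN σ hσ y⟩)) ∧
      (twoCocycleClass _ f = 0 → ∃ v : N → 𝕜, Continuous v ∧ (∀ a b : N, v (a * b) = v a + v b) ∧
        ∀ (q : Q) (a : N), ξ q a = v (MulAut.conjNormal (σ q)⁻¹ a) - v a) := by
  set X : TopRep.{v} 𝕜 P := TopRep.of (ContRepresentation.trivial 𝕜 P (ULift.{v} 𝕜)) with hX
  -- `ξ 1 = 0`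
  have hξ1 : ∀ a : N, ξ 1 a = 0 := by
    intro a
    have h := hcross 1 1 a
    rw [mul_one, map_one, inv_one, map_one, MulAut.one_apply] at h
    exact left_eq_add.1 h
  -- two identities between elements of `N`
  have hA : ∀ x y z : P,
      MulAut.conjNormal (σ (π x))
          (⟨y * z * (σ (π (y * z)))⁻¹, mul_section_inv_mem_of_split π N hN σ hσ (y * z)⟩ : N) =
        MulAut.conjNormal (σ (π x)) ⟨y * (σ (π y))⁻¹, mul_section_inv_mem_of_split π N hN σ hσ y⟩ *
          MulAut.conjNormal (σ (π x) * σ (π y))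
            ⟨z * (σ (π z))⁻¹, mul_section_inv_mem_of_split π N hN σ hσ z⟩ := by
    intro x y z
    apply Subtype.ext
    simp only [Subgroup.coe_mul, MulAut.conjNormal_apply, map_mul, MulAut.mul_apply, mul_inv_rev]
    group
  have hB : ∀ x y z : P,
      MulAut.conjNormal (σ (π x))⁻¹ (MulAut.conjNormal (σ (π x) * σ (π y))
          (⟨z * (σ (π z))⁻¹, mul_section_inv_mem_of_split π N hN σ hσ z⟩ : N)) =
        MulAut.conjNormal (σ (π y)) ⟨z * (σ (π z))⁻¹, mul_section_inv_mem_of_split π N hN σ hσ z⟩ := by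
    intro x y z
    apply Subtype.ext
    simp only [MulAut.conjNormal_apply, map_mul, MulAut.mul_apply, inv_inv]
    group
  have hB' : ∀ x y z : P,
      MulAut.conjNormal (σ (π (x * y)))
          (⟨z * (σ (π z))⁻¹, mul_section_inv_mem_of_split π N hN σ hσ z⟩ : N) =
        MulAut.conjNormal (σ (π x) * σ (π y))
          ⟨z * (σ (π z))⁻¹, mul_section_inv_mem_of_split π N hN σ hσ z⟩ := by
    intro x y z
    rw [map_mul, map_mul]
  -- the cochain
  let c : P × P → ULift.{v} 𝕜 := fun p => ULift.up (ξ (π p.1) (MulAut.conjNormal (σ (π p.1))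
    ⟨p.2 * (σ (π p.2))⁻¹, mul_section_inv_mem_of_split π N hN σ hσ p.2⟩))
  have hc_cont : Continuous c := by
    refine continuous_uliftUp.comp (hcont.comp (Continuous.prodMk (π.continuous.comp continuous_fst) ?_))
    refine continuous_induced_rng.2 ?_
    have : (Subtype.val ∘ fun p : P × P => MulAut.conjNormal (σ (π p.1))
        (⟨p.2 * (σ (π p.2))⁻¹, mul_section_inv_mem_of_split π N hN σ hσ p.2⟩ : N)) =
        fun p : P × P => σ (π p.1) * (p.2 * (σ (π p.2))⁻¹) * (σ (π p.1))⁻¹ := by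
      funext p
      simp only [Function.comp_apply, MulAut.conjNormal_apply]
    rw [this]
    fun_prop
  have hc_mem : (⟨c, hc_cont⟩ : C(P × P, X)) ∈ contTwoCocycles X := by
    rw [mem_contTwoCocycles_iff]
    intro x y z
    change c (y, z) + c (x, y * z) = c (x * y, z) + c (x, y)
    apply ULift.ext
    change ξ (π y) _ + ξ (π x) _ = ξ (π (x * y)) _ + ξ (π x) _
    dsimp only
    rw [hA x y z, hadd, hB', map_mul π x y, hcross, hB x y z]
    ring
  refine ⟨⟨⟨c, hc_cont⟩, hc_mem⟩, fun x y => rfl, fun h0 => ?_⟩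
  rw [twoCocycleClass_eq_zero_iff] at h0
  obtain ⟨b, hb⟩ := h0
  have hb' : ∀ x y : P, (c (x, y)).down = (b y).down - (b (x * y)).down + (b x).down := fun x y =>
    congrArg ULift.down (hb x y)
  -- `c` vanishes on `N × P`
  have hcN : ∀ (a : N) (y : P), (c (a, y)).down = 0 := by
    intro a y
    change ξ (π (a : P)) _ = 0
    rw [(hN _).1 a.2, hξ1]
  refine ⟨fun a => (b (a : P)).down,
    continuous_uliftDown.comp (b.continuous.comp continuous_subtype_val), fun a a' => ?_, fun q a => ?_⟩
  · have h := hb' (a : P) (a' : P)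
    rw [hcN] at h
    show (b ((a * a' : N) : P)).down = (b (a : P)).down + (b (a' : P)).down
    rw [Subgroup.coe_mul]
    linear_combination h
  · -- `c(σ q, a') = ξ q (σ q a' σ q⁻¹)` and `c(σ q a' σ q⁻¹, σ q) = 0`, with `a' = σ q⁻¹ a σ q`
    set a' : N := MulAut.conjNormal (σ q)⁻¹ a with ha'
    have hconj : MulAut.conjNormal (σ q) a' = a := by
      rw [ha', ← MulAut.mul_apply, ← map_mul, mul_inv_cancel, map_one, MulAut.one_apply]
    have h1 : (c (σ q, (a' : P))).down = ξ q a := by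
      change ξ (π (σ q)) _ = ξ q a
      rw [← hconj]
      congr 1
      · exact hσ q
      · apply Subtype.ext
        simp only [MulAut.conjNormal_apply, hσ, (hN _).1 a'.2, map_one, inv_one, mul_one]
    have h2 : (c (MulAut.conjNormal (σ q) a', σ q)).down = 0 := hcN _ _
    have h3 : ((MulAut.conjNormal (σ q) a' : N) : P) * σ q = σ q * (a' : P) := by
      rw [MulAut.conjNormal_apply, inv_mul_cancel_right]
    have e1 := hb' (σ q) (a' : P)
    have e2 := hb' (MulAut.conjNormal (σ q) a' : N) (σ q)
    rw [h1] at e1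
    rw [h2, h3, hconj] at e2
    linear_combination e1 - e2

/-- **`H¹(Q, H¹(N, 𝕜)) ↪ H²_cont(N ⋊ Q, 𝕜)`, element form**: for a split extension `P = N ⋊ σ(Q)` and a
jointly continuous crossed homomorphism `ξ` of `Q` into the continuous additive characters of `N` which
is NOT principal, the class of the cocycle `c_ξ` of `exists_contTwoCocycle_of_split` is a NON-ZERO
element of `H²_cont(P, 𝕜)` (Mathlib's `continuousCohomology 2` of the trivial representation on
`ULift 𝕜`). [cite: NeukirchSchmidtWingberg2008, (2.4.4)] -/
theorem exists_twoCocycleClass_ne_zero_of_split [LocallyCompactSpace P] (π : P →ₜ* Q)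
    (N : Subgroup P) [N.Normal] (hN : ∀ x : P, x ∈ N ↔ π x = 1) (σ : Q →ₜ* P)
    (hσ : ∀ q : Q, π (σ q) = q) (ξ : Q → N → 𝕜)
    (hadd : ∀ (q : Q) (a b : N), ξ q (a * b) = ξ q a + ξ q b)
    (hcross : ∀ (q₁ q₂ : Q) (a : N), ξ (q₁ * q₂) a = ξ q₁ a + ξ q₂ (MulAut.conjNormal (σ q₁)⁻¹ a))
    (hcont : Continuous fun p : Q × N => ξ p.1 p.2)
    (hnp : ∀ v : N → 𝕜, Continuous v → (∀ a b : N, v (a * b) = v a + v b) →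
      ∃ (q : Q) (a : N), ξ q a ≠ v (MulAut.conjNormal (σ q)⁻¹ a) - v a) :
    ∃ f : contTwoCocycles (TopRep.of (ContRepresentation.trivial 𝕜 P (ULift.{v} 𝕜))),
      twoCocycleClass _ f ≠ 0 := by
  obtain ⟨f, -, hf⟩ := exists_contTwoCocycle_of_split π N hN σ hσ ξ hadd hcross hcont
  refine ⟨f, fun h0 => ?_⟩
  obtain ⟨v, hvc, hvadd, hv⟩ := hf h0
  obtain ⟨q, a, hqa⟩ := hnp v hvc hvadd
  exact hqa (hv q a)

end Literature.NumberTheory.GaloisRepresentations
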